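import Literature.NumberTheory.EllipticCurves.HeegnerPointsKolyvaginSplitDescentProofs
import HarnessLib

/-!
# Kolyvagin's descent modulo `p^M`, split form with VISIBLE Čebotarev (any prime `p`; the form
# instantiable at `p = 2`): data, plumbing, the tie lemma, Claim A

Sibling of `HeegnerPointsKolyvaginSplitDescentProofs` (`KolyvaginDescent.SplitHypothesesM`: two
eigengroups `V^{±} ≤ V` meeting in `0`, split Selmer group, no parity hypothesis on `p`). That
structure's Čebotarev axiom `cebotarev` is McCallum's Cor. 3.2 for EVERY independent family of
non-zero classes lying in eigengroups ("pure" classes). In McCallum's setting (`p` odd,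
`V = H¹(K, E_{p^M})`) this is Prop. 3.1 / Cor. 3.2, whose proof evaluates classes on
`Gal(K̄/K(E_{p^M}))` and needs the restriction `H¹(K, E_{p^M}) → H¹(K(E_{p^M}), E_{p^M})` to be
INJECTIVE on the span of the family — automatic for `p` odd from Gross 1991, Prop. 9.1
(`H¹(K(E_p)/K, E_p) = 0`; McCallum p. 299: *"the restriction map … is injective"*). At `p = 2`,
in Kolyvagin's frame for the pair `(E, E^D)` over `ℚ` (Izv. 1989, §3) with
`V = H¹(ℚ, E^{ε}[2^M]) × H¹(ℚ, E^{-ε}[2^M])`, it is NOT automatic, for two reasons: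

* (E) *entanglement of bottom bits*: `E[2] = E^D[2]` as Galois modules, so for
  `α ∈ H¹(ℚ, E[2])` the pure classes `(ια, 0)` and `(0, ι′α)` are independent in `V` but restrict
  to the SAME class over `K`, hence have tied localisations at every Kolyvagin prime — Cor. 3.2
  with different prescriptions for the two is false;
* (X) *the inflated class*: for `ρ_{E,4}` onto, `H¹(Gal(ℚ(E[2^M])/ℚ), E[2]) = 𝔽₂ · ξ_E` for all
  `M ≥ 2` (Lawson–Wuthrich 2016, §7.1: `H¹(G₂, E[4]) ≠ 0`; the class is `ξ_E = −Δ_E h′(θ)` in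
  `L^×/L^{×2}`, `L` the `2`-division algebra), and its image in `H¹(ℚ, E^{±}[2^M])` restricts to
  `0` on `Gal(ℚ̄/K(E[2^M]))`, so it is locally ZERO at every Kolyvagin prime `ℓ` (there
  `Frob_ℓ = τ` and `H¹(⟨τ⟩, E[2^M]) = 0` on `Δ(E) < 0`) — Cor. 3.2 prescribing it a non-zero local
  order is false (although the class is not locally trivial everywhere: Lawson–Wuthrich §8, the
  localisation kernel `L(G_i)` vanishes for the full image).

This file states the axiom in the form that IS true at `2` and keeps McCallum's proofs intact:

* the data carry an additive map `rK : V →+ H` ("restriction to `K(E_{p^M})`", `H` abstract) and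
  Čebotarev is required only for pure families that are **independent after `rK`**
  (`∑ aᵢ rK(cᵢ) = 0 ⟹ aᵢ cᵢ = 0`; this implies independence in `V`). At `2` this is EXACTLY the
  hypothesis set of the tree's signed Cor. 3.2 over `K`
  (`GenusExact.equivariantChebotarevAtTwo_signed_of_not_isSquare`, route `GenusKolyvaginAtTwo`:
  `K`-independence plus its binder `hres` "restriction to `Γ_{K(E[2^M])}` injective on the span");
* at Kolyvagin primes the Selmer local condition FACTORS THROUGH `rK` (`mem_loc_pl_iff`:
  `u ∈ Loc λ ↔ rK u ∈ LocK ℓ` for pure `u`; true at `2` because two `K`-classes with the same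
  restriction to `K(E[2^M])` differ by an inflated class, which dies at `λ`);
* the Selmer group is **visible**: `rK` is injective on `Sel` (`sel_visible`). For `p` odd this is
  Gross's Prop. 9.1; at `2` for the pair it reads: `Sel₂(E^{ε}/ℚ) ⊕ Sel₂(E^{-ε}/ℚ) ⊕ 𝔽₂ ξ_E` is a
  DIRECT sum inside `H¹(ℚ, E[2])` — a checkable condition on the pair (the "habitat condition
  (H2)" of the BSD route `GenusKolyvaginAtTwo`, LINE 6, crux Q3′; it refines the condition
  `Sel₂(E) ∩ Sel₂(E^{d_K}) = 0` recorded by seat `bsd-line-gk2-p2` g9).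

With these, the visibility of each family McCallum's argument feeds to Čebotarev is PROVED inside
the descent (this is the one new lemma, `eq_zero_of_rK_eq`: a pure class supported on Kolyvagin
primes and `rK`-tied to a Selmer class of the opposite sign is itself Selmer — the local conditions
at Kolyvagin primes transfer through `rK`, the others hold by Lemma 4.3 — hence both vanish by
`sel_visible` and `V⁺ ∩ V⁻ = 0`), and Claim A, Prop. 10.2, Claim B, the annihilation theorem, the
exact case `M₀ = 0` and the lower-bound element follow VERBATIM (this file: data, plumbing — public,
for the sibling files —, the tie lemma, Claim A and Prop. 10.2; sibling
`HeegnerPointsKolyvaginVisibleDescentClaimBProofs`: Claim B onwards and `SplitHypothesesM.toVisible`,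
showing that the visible form GENERALISES the split form).

No Galois cohomology, no named fact (net debt `0`); nothing here is a claim about BSD.

## References

* W. G. McCallum, *Kolyvagin's work on Shafarevich–Tate groups*, in *`L`-functions and arithmetic
  (Durham 1989)*, LMS Lecture Note Ser. 153 (1991) 295–316: p. 299 (restriction to `K(E_{p^M})`
  injective), Prop. 3.1, Cor. 3.2, Lemma 4.3, Prop. 4.4, Lemma 5.3, §5. [McCallumLMS1991]
* B. H. Gross, *Kolyvagin's work on modular elliptic curves*, same volume, 235–256: Prop. 9.1
  (`H¹(K(E_p)/K, E_p) = 0`), §10 (Claims 10.1, 10.3, Prop. 10.2). [GrossLMS1991]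
* V. A. Kolyvagin, *Finiteness of `E(ℚ)` and `Ш(E, ℚ)` for a subclass of Weil curves*, Math.
  USSR-Izv. 32 (1989) 523–541: Thm. `B_l` at `l = 2`, §3 (the pair `(E, E^D)` over `ℚ`).
  [Kolyvagin1989Izv]
* T. Lawson, C. Wuthrich, *Vanishing of some Galois cohomology groups for elliptic curves*, in
  *Elliptic curves, modular forms and Iwasawa theory*, Springer PROMS 188 (2016), §7.1 and §8
  (arXiv:1505.02940). [LawsonWuthrich2016]
-/

noncomputable section

open scoped Classical

open WeierstrassCurve

namespace Literature.NumberTheory.EllipticCurves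

namespace KolyvaginDescent

/-! ## The visible split data -/

/-- **Kolyvagin's descent modulo `p^M`, split form, VISIBLE Čebotarev (any prime `p`).** The data
of `KolyvaginDescent.SplitHypothesesM` (see its docstring for the dictionary with McCallum 1991,
§§2–5, and Gross 1991, §10) with the Čebotarev axiom replaced by the visible form and three new
items: an additive map `rK : V →+ H` (at `p` odd over `K`: the identity, or restriction to
`K(E_{p^M})`; at `p = 2` for the pair `(E, E^D)` over `ℚ`: restriction to `K(E[2^M])`), the local
conditions `LocK ℓ ≤ H` through which the Selmer condition at a Kolyvagin prime factors for pure
classes (`mem_loc_pl_iff`), and the visibility of the Selmer group (`sel_visible`, Gross 1991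
Prop. 9.1 at `p` odd: *"`H¹(K(E_p)/K, E_p) = 0`"*, McCallum p. 299: *"the restriction map
`H¹(K, E_{p^M}) → H¹(K(E_{p^M}), E_{p^M})` is injective"*). The axiom `cebotarev` is McCallum's
Cor. 3.2 (*"Suppose `c₁, …, c_r ∈ H¹(K, E_{p^M})` are independent eigenvectors for `τ` … there
exist infinitely many primes `ℓ ∈ S₁(M)` such that `ord c_{i,λ} = p^{N_i}`"*) for pure families
that are independent AFTER `rK` — the hypothesis under which its proof (evaluation on
`Gal(K̄/K(E_{p^M}))`, Prop. 3.1) runs, and the hypothesis set of the tree's signed Cor. 3.2 at `2`.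
[cite: McCallumLMS1991, §3 (p. 299, Prop. 3.1, Cor. 3.2), §§4–5 (Lemma 4.3, Prop. 4.4, Lemma 5.3)]
[cite: GrossLMS1991, Prop. 9.1 and §10] [cite: Kolyvagin1989Izv, §3 (the pair (E, E^D) over ℚ at l = 2)] -/
structure VisibleSplitHypothesesM (V : Type*) [AddCommGroup V] (Pl : Type*) (H : Type*)
    [AddCommGroup H] where
  /-- The prime `p` (any prime, `2` allowed). -/
  p : ℕ
  /-- `p` is prime. -/
  hp : p.Prime
  /-- The level `M`. -/
  M : ℕ
  /-- `V` is killed by `p^M`. -/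
  torsion : ∀ v : V, ((p : ℤ) ^ M) • v = 0
  /-- The two pure parts `V^{ν} = part ν`, `ν = ±1` (the `τ`-eigengroups at `p` odd over `K`; the two
  members `H¹(ℚ, E^{±ε}[2^M])` of the pair at `p = 2`). -/
  part : ℤ → AddSubgroup V
  /-- `V⁺ ∩ V⁻ = 0`. -/
  part_disjoint : ∀ v : V, v ∈ part 1 → v ∈ part (-1) → v = 0
  /-- The Selmer group `Sel ≤ V`. -/
  Sel : AddSubgroup V
  /-- `Sel` is split. -/
  sel_split : ∀ s ∈ Sel, ∃ s₁ s₂ : V, (s₁ ∈ Sel ∧ s₁ ∈ part 1) ∧ (s₂ ∈ Sel ∧ s₂ ∈ part (-1)) ∧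
    s = s₁ + s₂
  /-- The Selmer local conditions, indexed by the places `v`. -/
  Loc : Pl → AddSubgroup V
  /-- `Sel` is cut out by the local conditions at all places. -/
  mem_sel_iff : ∀ s, s ∈ Sel ↔ ∀ v, s ∈ Loc v
  /-- Kolyvagin primes `ℓ ∈ S₁(M)`. -/
  Kol : ℕ → Prop
  /-- Kolyvagin primes are primes. -/
  prime_of_kol : ∀ ℓ, Kol ℓ → ℓ.Prime
  /-- The place attached to a Kolyvagin prime. -/
  pl : ℕ → Pl
  /-- "The place `v` divides `n`". -/
  Dv : Pl → ℕ → Prop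
  /-- `pl ℓ` is the unique place dividing the Kolyvagin prime `ℓ`. -/
  dv_iff : ∀ ℓ, Kol ℓ → ∀ v, Dv v ℓ ↔ v = pl ℓ
  /-- A place dividing `ℓ ℓ'` divides `ℓ` or `ℓ'`. -/
  dv_mul : ∀ ℓ ℓ', Kol ℓ → Kol ℓ' → ∀ v, Dv v (ℓ * ℓ') → Dv v ℓ ∨ Dv v ℓ'
  /-- The strict local conditions "`c_λ = 0`" at Kolyvagin primes. -/
  A : ℕ → AddSubgroup V
  /-- `x = δ_M x₀`. -/
  x : V
  /-- `x ∈ Sel`. -/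
  x_mem : x ∈ Sel
  /-- `x` has order `p^M`. -/
  x_ord : ((p : ℤ) ^ (M - 1)) • x ≠ 0
  /-- `M₀ = ord_p [E(K) : ℤ y_K]`. -/
  M₀ : ℕ
  /-- The sign `ε` of `y_K`. -/
  ε : ℤ
  /-- `ε = ±1`. -/
  hε : ε = 1 ∨ ε = -1
  /-- `x ∈ V^{ε}`. -/
  x_part : x ∈ part ε
  /-- Kolyvagin's classes `c_M(n)`. -/
  c : ℕ → V
  /-- `c_M(1) = p^{M₀} x`. -/
  c_one : c 1 = ((p : ℤ) ^ M₀) • x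
  /-- **Gross 1991, Prop. 5.4 (2)**: `c_M(n) ∈ V^{ε (-1)^{r(n)}}`. -/
  c_part : ∀ n, KolSupp Kol n → c n ∈ part (ε * (-1) ^ n.primeFactors.card)
  /-- **McCallum 1991, Lemma 4.3**: `c_M(n)_v ∈ δ(E(K_v))` at every place `v` prime to `n`. -/
  c_mem_loc : ∀ n, KolSupp Kol n → ∀ v, ¬ Dv v n → c n ∈ Loc v
  /-- **McCallum 1991, Prop. 4.4**: `p^a d_M(ℓm)_λ = 0 ↔ p^a c_M(m)_λ = 0`. -/
  c_mem_loc_iff : ∀ ℓ m, Kol ℓ → KolSupp Kol (ℓ * m) → ∀ a : ℕ,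
    (((p : ℤ) ^ a) • c (ℓ * m) ∈ Loc (pl ℓ)) ↔ ((p : ℤ) ^ a) • c m ∈ A ℓ
  /-- **McCallum 1991, Lemma 5.3 with Prop. 2.2** (local duality at `λ` and reciprocity). -/
  duality : ∀ ℓ, Kol ℓ → ∀ ν : ℤ, (ν = 1 ∨ ν = -1) → ∀ d, d ∈ part ν →
    (∀ v, v ≠ pl ℓ → d ∈ Loc v) → ∀ s ∈ Sel, s ∈ part ν →
    ∀ a, a < M → ((p : ℤ) ^ a) • d ∉ Loc (pl ℓ) → ((p : ℤ) ^ (M - 1 - a)) • s ∈ A ℓ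
  /-- **Restriction to `K(E_{p^M})`** (abstract): the map after which Čebotarev sees classes. -/
  rK : V →+ H
  /-- The Selmer local condition at the Kolyvagin prime `ℓ`, read in `H`. -/
  LocK : ℕ → AddSubgroup H
  /-- At a Kolyvagin prime the local condition of a PURE class factors through `rK` (at `2`: two
  classes with the same restriction to `K(E[2^M])` differ by an inflated class, which dies at `λ`
  since `Frob_λ = τ` and `H¹(⟨τ⟩, E[2^M]) = 0` on `Δ(E) < 0`). -/
  mem_loc_pl_iff : ∀ ℓ, Kol ℓ → ∀ u : V, (u ∈ part 1 ∨ u ∈ part (-1)) →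
    (u ∈ Loc (pl ℓ) ↔ rK u ∈ LocK ℓ)
  /-- **The Selmer group is visible**: `rK` is injective on `Sel` (Gross 1991, Prop. 9.1 at `p`
  odd; at `2` for the pair: `Sel₂(E^{ε}) ⊕ Sel₂(E^{-ε}) ⊕ 𝔽₂ξ_E` direct in `H¹(ℚ, E[2])`). -/
  sel_visible : ∀ s ∈ Sel, rK s = 0 → s = 0
  /-- **McCallum 1991, Cor. 3.2, visible form**: non-zero classes lying in eigengroups and
  INDEPENDENT AFTER `rK` acquire prescribed local orders `p^{N_i}` (`N_i ≤ ord`) at infinitely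
  many Kolyvagin primes. -/
  cebotarev : ∀ (r : ℕ) (cs : Fin r → V) (Nv : Fin r → ℕ), (∀ i, cs i ≠ 0) →
    (∀ i, Nv i ≠ 0 → ((p : ℤ) ^ (Nv i - 1)) • cs i ≠ 0) →
    (∀ i, ∃ e : ℤ, (e = 1 ∨ e = -1) ∧ cs i ∈ part e) →
    (∀ a : Fin r → ℤ, ∑ i, a i • rK (cs i) = 0 → ∀ i, a i • cs i = 0) →
    ∀ b : ℕ, ∃ ℓ, b < ℓ ∧ Kol ℓ ∧ ∀ i, ((p : ℤ) ^ Nv i) • cs i ∈ A ℓ ∧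
      (Nv i ≠ 0 → ((p : ℤ) ^ (Nv i - 1)) • cs i ∉ A ℓ)

namespace VisibleSplitHypothesesM

variable {V : Type*} [AddCommGroup V] {Pl : Type*} {H : Type*} [AddCommGroup H]
variable (S : VisibleSplitHypothesesM V Pl H)

/-! ### Signs and eigengroups -/

/-- `ε² = 1`. [folklore] -/
private theorem ε_mul_ε : S.ε * S.ε = 1 := by
  rcases S.hε with h | h <;> simp [h]

/-- `-ε = ±1`. [folklore] -/
private theorem neg_ε_sign : -S.ε = 1 ∨ -S.ε = -1 := by
  rcases S.hε with h | h <;> simp [h]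

/-- The signs `ε (-1)^i` are `±1`. [folklore] -/
private theorem sign_pow_cases (i : ℕ) : S.ε * (-1) ^ i = 1 ∨ S.ε * (-1) ^ i = -1 := by
  rcases S.hε with h | h <;> rcases neg_one_pow_eq_or ℤ i with h' | h' <;> simp [h, h']

/-- `V^{e} ∩ V^{-e} = 0` for a sign `e = ±1`. [folklore] -/
private theorem eq_zero_of_mem_part_of_mem_part_neg {e : ℤ} (he : e = 1 ∨ e = -1) {v : V}
    (h₁ : v ∈ S.part e) (h₂ : v ∈ S.part (-e)) : v = 0 := by
  rcases he with rfl | rfl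
  · exact S.part_disjoint v h₁ h₂
  · rw [neg_neg] at h₂
    exact S.part_disjoint v h₂ h₁

/-- A class in `V^{e}`, `e = ±1`, is pure (lies in `V⁺` or in `V⁻`). [folklore] -/
private theorem pure_of_mem_part {e : ℤ} (he : e = 1 ∨ e = -1) {v : V} (h : v ∈ S.part e) :
    v ∈ S.part 1 ∨ v ∈ S.part (-1) := by
  rcases he with rfl | rfl
  · exact Or.inl h
  · exact Or.inr h

/-- Every Selmer class is the sum of a Selmer class in `V^{ε}` and one in `V^{-ε}`. [folklore] -/
private theorem sel_split_ε {s : V} (hs : s ∈ S.Sel) :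
    ∃ sp sm : V, (sp ∈ S.Sel ∧ sp ∈ S.part S.ε) ∧ (sm ∈ S.Sel ∧ sm ∈ S.part (-S.ε)) ∧
      s = sp + sm := by
  obtain ⟨s₁, s₂, ⟨h₁, h₁'⟩, ⟨h₂, h₂'⟩, hsum⟩ := S.sel_split s hs
  rcases S.hε with h | h
  · exact ⟨s₁, s₂, ⟨h₁, by rw [h]; exact h₁'⟩, ⟨h₂, by rw [h]; exact h₂'⟩, hsum⟩
  · exact ⟨s₂, s₁, ⟨h₂, by rw [h]; exact h₂'⟩, ⟨h₁, by rw [h, neg_neg]; exact h₁'⟩,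
      by rw [hsum, add_comm]⟩

/-! ### Exponents: `ord s = p^{expo s}` -/

/-- Every element is killed by some power of `p`. [folklore] -/
private theorem exists_pow_zsmul_eq_zero (s : V) : ∃ a : ℕ, ((S.p : ℤ) ^ a) • s = 0 :=
  ⟨S.M, S.torsion s⟩

/-- `expo s`: the least `a` with `p^a • s = 0`, so that `ord s = p^{expo s}`. [folklore] -/
def expo (s : V) : ℕ :=
  Nat.find (S.exists_pow_zsmul_eq_zero s)

/-- `p^{expo s} • s = 0`. [folklore] -/
private theorem pow_expo_zsmul (s : V) : ((S.p : ℤ) ^ S.expo s) • s = 0 :=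
  Nat.find_spec (S.exists_pow_zsmul_eq_zero s)

/-- `p^a • s ≠ 0` for `a < expo s`. [folklore] -/
private theorem pow_zsmul_ne_zero_of_lt {s : V} {a : ℕ} (ha : a < S.expo s) : ((S.p : ℤ) ^ a) • s ≠ 0 :=
  Nat.find_min (S.exists_pow_zsmul_eq_zero s) ha

/-- `expo s ≤ a` as soon as `p^a • s = 0`. [folklore] -/
private theorem expo_le_of_pow_zsmul_eq_zero {s : V} {a : ℕ} (h : ((S.p : ℤ) ^ a) • s = 0) :
    S.expo s ≤ a :=
  Nat.find_min' (S.exists_pow_zsmul_eq_zero s) h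

/-- `expo s ≤ M`. [folklore] -/
private theorem expo_le (s : V) : S.expo s ≤ S.M :=
  S.expo_le_of_pow_zsmul_eq_zero (S.torsion s)

/-- The hypothesis `N ≤ ord` of `cebotarev` holds for `N = expo s`. [folklore] -/
private theorem pow_expo_sub_one_zsmul_ne_zero {s : V} (h : S.expo s ≠ 0) :
    ((S.p : ℤ) ^ (S.expo s - 1)) • s ≠ 0 :=
  S.pow_zsmul_ne_zero_of_lt (Nat.sub_one_lt h)

/-- `expo s ≠ 0` forces `s ≠ 0`. [folklore] -/
private theorem ne_zero_of_expo_ne_zero {s : V} (h : S.expo s ≠ 0) : s ≠ 0 := by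
  rintro rfl
  exact h (Nat.le_zero.mp (S.expo_le_of_pow_zsmul_eq_zero (a := 0) (smul_zero _)))

/-- If `p^a • s ∈ H` but `p^{expo s - 1} • s ∉ H` then `expo s ≤ a`. [folklore] -/
private theorem expo_le_of_mem_of_not_mem {G : AddSubgroup V} {s : V} {a : ℕ}
    (hmem : ((S.p : ℤ) ^ a) • s ∈ G) (hnot : S.expo s ≠ 0 → ((S.p : ℤ) ^ (S.expo s - 1)) • s ∉ G) :
    S.expo s ≤ a := by
  by_contra hlt
  have hlt := Nat.lt_of_not_le hlt
  have hne : S.expo s ≠ 0 := by omega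
  exact hnot hne (pow_zsmul_mem_of_le (by omega) hmem)

/-! ### `y = δ_M y_K = p^{M₀} x` -/

/-- `y = c(1) = p^{M₀} x`, the image `δ_M y_K` of the Heegner point (McCallum 1991, Lemma 5.1).
[cite: McCallumLMS1991, Lemma 5.1] -/
def y : V := ((S.p : ℤ) ^ S.M₀) • S.x

/-- `c 1 = y`. [folklore] -/
private theorem c_one' : S.c 1 = S.y := S.c_one

/-- `y ∈ Sel`. [folklore] -/
private theorem y_mem : S.y ∈ S.Sel := S.Sel.zsmul_mem S.x_mem _

/-- `y ∈ V^{ε}`. [folklore] -/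
private theorem y_part : S.y ∈ S.part S.ε := (S.part S.ε).zsmul_mem S.x_part _

/-- `x` has order exactly `p^M`: `k • x = 0 ↔ p^M ∣ k`. [folklore] -/
private theorem zsmul_x_eq_zero_iff (k : ℤ) : k • S.x = 0 ↔ ((S.p : ℤ) ^ S.M) ∣ k :=
  zsmul_eq_zero_iff_prime_pow_dvd S.hp (S.torsion S.x) S.x_ord k

/-- `M ≠ 0` (since `x ≠ 0`). [folklore] -/
private theorem M_ne_zero : S.M ≠ 0 := by
  intro h
  apply S.x_ord
  have := S.torsion S.x
  rwa [h] at this ⊢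

/-- If `M₀ < M` then `p^{M - M₀ - 1} y = p^{M-1} x ≠ 0`: `ord y = p^{M - M₀}`. [folklore] -/
private theorem pow_zsmul_y_ne_zero (h : S.M₀ < S.M) : ((S.p : ℤ) ^ (S.M - S.M₀ - 1)) • S.y ≠ 0 := by
  rw [y, smul_smul, ← pow_add, show S.M - S.M₀ - 1 + S.M₀ = S.M - 1 by omega]
  exact S.x_ord

/-- `x ≠ 0`. [folklore] -/
private theorem x_ne : S.x ≠ 0 := fun h ↦ S.x_ord (by rw [h, smul_zero])

/-- `y ≠ 0` if `M₀ < M`. [folklore] -/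
private theorem y_ne (h : S.M₀ < S.M) : S.y ≠ 0 := fun h0 ↦ S.pow_zsmul_y_ne_zero h (by rw [h0, smul_zero])

/-! ### Eigengroups and local conditions of Kolyvagin's classes -/

/-- `c(ℓ)` lies in the `-ε`-eigengroup. [cite: GrossLMS1991, Prop. 5.4 (2)] -/
theorem c_part_prime {ℓ : ℕ} (hℓ : S.Kol ℓ) : S.c ℓ ∈ S.part (-S.ε) := by
  have := S.c_part ℓ (kolSupp_prime (S.prime_of_kol ℓ hℓ) hℓ)
  rwa [card_primeFactors_prime (S.prime_of_kol ℓ hℓ), pow_one, mul_neg_one] at this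

/-- `c(ℓℓ')` lies in the `ε`-eigengroup for distinct Kolyvagin primes.
[cite: GrossLMS1991, Prop. 5.4 (2)] -/
theorem c_part_mul {ℓ ℓ' : ℕ} (hℓ : S.Kol ℓ) (hℓ' : S.Kol ℓ') (hne : ℓ ≠ ℓ') :
    S.c (ℓ * ℓ') ∈ S.part S.ε := by
  have := S.c_part (ℓ * ℓ') (kolSupp_mul (S.prime_of_kol ℓ hℓ) (S.prime_of_kol ℓ' hℓ') hne hℓ hℓ')
  rwa [card_primeFactors_mul (S.prime_of_kol ℓ hℓ) (S.prime_of_kol ℓ' hℓ') hne, even_two.neg_pow,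
    one_pow, mul_one] at this

/-- `c(ℓ)` satisfies the Selmer condition away from `λ` (Lemma 4.3).
[cite: McCallumLMS1991, Lemma 4.3] -/
private theorem c_mem_loc_of_ne {ℓ : ℕ} (hℓ : S.Kol ℓ) {v : Pl} (hv : v ≠ S.pl ℓ) : S.c ℓ ∈ S.Loc v :=
  S.c_mem_loc ℓ (kolSupp_prime (S.prime_of_kol ℓ hℓ) hℓ) v fun h ↦ hv ((S.dv_iff ℓ hℓ v).mp h)

/-- Prop. 4.4 at `n = ℓ`, `m = 1`: `p^a d(ℓ)_λ = 0 ↔ p^a y_λ = 0`.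
[cite: McCallumLMS1991, Prop. 4.4] -/
private theorem c_mem_loc_iff_one {ℓ : ℕ} (hℓ : S.Kol ℓ) (a : ℕ) :
    (((S.p : ℤ) ^ a) • S.c ℓ ∈ S.Loc (S.pl ℓ)) ↔ ((S.p : ℤ) ^ a) • S.y ∈ S.A ℓ := by
  have := S.c_mem_loc_iff ℓ 1 hℓ (by rw [mul_one]; exact kolSupp_prime (S.prime_of_kol ℓ hℓ) hℓ) a
  rwa [mul_one, S.c_one'] at this

/-- **`c_M(ℓ)` is supported on the Kolyvagin place `λ`**: it satisfies the Selmer condition at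
every place which is not the place of a Kolyvagin prime (Lemma 4.3 with `dv_iff`).
[cite: McCallumLMS1991, Lemma 4.3] -/
theorem c_mem_loc_of_forall_ne {ℓ : ℕ} (hℓ : S.Kol ℓ) {v : Pl} (hv : ∀ q, S.Kol q → v ≠ S.pl q) :
    S.c ℓ ∈ S.Loc v :=
  S.c_mem_loc_of_ne hℓ (hv ℓ hℓ)

/-! ### Independence from eigengroups (no parity hypothesis on `p`) -/

/-- Two classes in opposite eigengroups are independent: a relation `a₀ y + a₁ s = 0` forces
`a₀ y = 0` and `a₁ s = 0`, because `a₀ y = -a₁ s ∈ V^{e} ∩ V^{-e} = 0`. [folklore] -/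
private theorem indep_of_part {y s : V} {e : ℤ} (he : e = 1 ∨ e = -1) (hy : y ∈ S.part e)
    (hs : s ∈ S.part (-e)) {a₀ a₁ : ℤ} (h : a₀ • y + a₁ • s = 0) :
    a₀ • y = 0 ∧ a₁ • s = 0 := by
  have hy' : a₀ • y ∈ S.part e := (S.part e).zsmul_mem hy _
  have hs' : a₁ • s ∈ S.part (-e) := (S.part (-e)).zsmul_mem hs _
  have heq : a₀ • y = -(a₁ • s) := eq_neg_of_add_eq_zero_left h
  have hy'' : a₀ • y ∈ S.part (-e) := by
    rw [heq]
    exact (S.part (-e)).neg_mem hs'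
  have h0 : a₀ • y = 0 := S.eq_zero_of_mem_part_of_mem_part_neg he hy' hy''
  refine ⟨h0, ?_⟩
  rwa [h0, zero_add] at h

/-- Three classes `x, s ∈ V^{e}`, `c ∈ V^{-e}` with `{x, s}` independent are independent.
[folklore] -/
private theorem indep_of_part₃ {x s c : V} {e : ℤ} (he : e = 1 ∨ e = -1) (hx : x ∈ S.part e)
    (hs : s ∈ S.part e) (hc : c ∈ S.part (-e))
    (hind : ∀ a₀ a₁ : ℤ, a₀ • x + a₁ • s = 0 → a₁ • s = 0) {a₀ a₁ a₂ : ℤ}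
    (h : a₀ • x + a₁ • s + a₂ • c = 0) : a₀ • x = 0 ∧ a₁ • s = 0 ∧ a₂ • c = 0 := by
  have hxs : a₀ • x + a₁ • s ∈ S.part e :=
    (S.part e).add_mem ((S.part e).zsmul_mem hx _) ((S.part e).zsmul_mem hs _)
  have h' : (1 : ℤ) • (a₀ • x + a₁ • s) + a₂ • c = 0 := by rwa [one_zsmul]
  obtain ⟨h1, h2⟩ := S.indep_of_part he hxs hc h'
  rw [one_zsmul] at h1
  have ha1 : a₁ • s = 0 := hind a₀ a₁ h1
  rw [ha1, add_zero] at h1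
  exact ⟨h1, ha1, h2⟩

/-! ### Visibility: the tie lemma and the visible families of McCallum's argument

This is the one new ingredient. A pure class `w` "supported on Kolyvagin primes" (Selmer at every
place which is not the place of a Kolyvagin prime — every `ℤ`-multiple of a Kolyvagin class `c(ℓ)`
is such, by Lemma 4.3) whose image `rK w` equals that of a Selmer class `u` of the opposite sign is
itself Selmer (the conditions at Kolyvagin primes transfer through `rK` by `mem_loc_pl_iff`), so
`u - w ∈ Sel ∩ ker rK = 0` (`sel_visible`) and `u = w ∈ V^{e} ∩ V^{-e} = 0`. Hence every family
that McCallum's §5 feeds to Čebotarev — Selmer classes of both signs plus ONE class supported on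
Kolyvagin primes — is independent after `rK` as soon as it is independent in `V`. At `p` odd
(`rK` injective, Gross Prop. 9.1) this is empty; at `2` it is exactly what survives of Prop. 9.1.
-/

/-- **The tie lemma.** `u ∈ Sel ∩ V^{e}`, `w ∈ V^{-e}` Selmer at every place which is not the
place of a Kolyvagin prime, `rK u = rK w` ⟹ `u = 0` and `w = 0`.
[cite: GrossLMS1991, Prop. 9.1 (its role in McCallum §3)] [cite: McCallumLMS1991, §3 (p. 299), Lemma 4.3] -/
theorem eq_zero_of_rK_eq {e : ℤ} (he : e = 1 ∨ e = -1) {u w : V} (hu : u ∈ S.Sel)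
    (hue : u ∈ S.part e) (hwe : w ∈ S.part (-e))
    (hw : ∀ v, (∀ q, S.Kol q → v ≠ S.pl q) → w ∈ S.Loc v) (h : S.rK u = S.rK w) :
    u = 0 ∧ w = 0 := by
  have hne : -e = 1 ∨ -e = -1 := by rcases he with rfl | rfl <;> simp
  have hup : u ∈ S.part 1 ∨ u ∈ S.part (-1) := S.pure_of_mem_part he hue
  have hwp : w ∈ S.part 1 ∨ w ∈ S.part (-1) := S.pure_of_mem_part hne hwe
  -- `w` is Selmer: at Kolyvagin places the condition of `u` transfers through `rK`
  have hwS : w ∈ S.Sel := by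
    refine (S.mem_sel_iff w).mpr fun v ↦ ?_
    by_cases hv : ∃ q, S.Kol q ∧ v = S.pl q
    · obtain ⟨q, hq, rfl⟩ := hv
      have huq : u ∈ S.Loc (S.pl q) := (S.mem_sel_iff u).mp hu _
      exact (S.mem_loc_pl_iff q hq w hwp).mpr (h ▸ (S.mem_loc_pl_iff q hq u hup).mp huq)
    · push Not at hv
      exact hw v fun q hq hvq ↦ hv q hq hvq
  -- `u - w ∈ Sel ∩ ker rK = 0`
  have hsub : u - w = 0 := S.sel_visible _ (S.Sel.sub_mem hu hwS) (by rw [map_sub, h, sub_self])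
  have huw : u = w := sub_eq_zero.mp hsub
  have hu0 : u = 0 := S.eq_zero_of_mem_part_of_mem_part_neg he hue (huw ▸ hwe)
  exact ⟨hu0, by rw [← huw, hu0]⟩

/-- A Selmer class killed by `rK` after scaling: `a • rK u = 0 ⟹ a • u = 0`. [folklore] -/
private theorem zsmul_eq_zero_of_zsmul_rK_eq_zero {u : V} (hu : u ∈ S.Sel) {a : ℤ}
    (h : a • S.rK u = 0) : a • u = 0 :=
  S.sel_visible _ (S.Sel.zsmul_mem hu a) (by rw [map_zsmul, h])

/-- **Visibility of a Selmer pair of opposite signs** (`{y, s}` in Claim A): a relation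
`a₀ rK u + a₁ rK s = 0` with `u ∈ Sel ∩ V^{e}`, `s ∈ Sel ∩ V^{-e}` forces `a₀ u = 0` and
`a₁ s = 0`. [cite: McCallumLMS1991, §3 (p. 299)] [cite: GrossLMS1991, Prop. 9.1] -/
theorem vis_of_sel_pair {e : ℤ} (he : e = 1 ∨ e = -1) {u s : V} (hu : u ∈ S.Sel)
    (hue : u ∈ S.part e) (hs : s ∈ S.Sel) (hse : s ∈ S.part (-e)) {a₀ a₁ : ℤ}
    (h : a₀ • S.rK u + a₁ • S.rK s = 0) : a₀ • u = 0 ∧ a₁ • s = 0 := by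
  have hsum : a₀ • u + a₁ • s ∈ S.Sel :=
    S.Sel.add_mem (S.Sel.zsmul_mem hu _) (S.Sel.zsmul_mem hs _)
  have h0 : a₀ • u + a₁ • s = 0 :=
    S.sel_visible _ hsum (by rw [map_add, map_zsmul, map_zsmul, h])
  exact S.indep_of_part he hue hse h0

/-- **Visibility of McCallum's triple `{x, s, c(ℓ)}`** (Claim B, step B): `x, s ∈ Sel ∩ V^{e}`
independent, `c ∈ V^{-e}` Selmer at every place which is not the place of a Kolyvagin prime; a
relation `a₀ rK x + a₁ rK s + a₂ rK c = 0` forces `a₀ x = a₁ s = a₂ c = 0` (tie lemma applied to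
`u = a₀ x + a₁ s`, `w = -a₂ c`). [cite: McCallumLMS1991, §5 (proof of Thm. 5.4), §3 (p. 299)] -/
theorem vis_of_sel_sel_kol {e : ℤ} (he : e = 1 ∨ e = -1) {x s c : V} (hx : x ∈ S.Sel)
    (hxe : x ∈ S.part e) (hs : s ∈ S.Sel) (hse : s ∈ S.part e) (hce : c ∈ S.part (-e))
    (hc : ∀ v, (∀ q, S.Kol q → v ≠ S.pl q) → c ∈ S.Loc v)
    (hind : ∀ a₀ a₁ : ℤ, a₀ • x + a₁ • s = 0 → a₁ • s = 0) {a₀ a₁ a₂ : ℤ}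
    (h : a₀ • S.rK x + a₁ • S.rK s + a₂ • S.rK c = 0) :
    a₀ • x = 0 ∧ a₁ • s = 0 ∧ a₂ • c = 0 := by
  have hu : a₀ • x + a₁ • s ∈ S.Sel := S.Sel.add_mem (S.Sel.zsmul_mem hx _) (S.Sel.zsmul_mem hs _)
  have hue : a₀ • x + a₁ • s ∈ S.part e :=
    (S.part e).add_mem ((S.part e).zsmul_mem hxe _) ((S.part e).zsmul_mem hse _)
  have hwe : -(a₂ • c) ∈ S.part (-e) := (S.part (-e)).neg_mem ((S.part (-e)).zsmul_mem hce _)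
  have hw : ∀ v, (∀ q, S.Kol q → v ≠ S.pl q) → -(a₂ • c) ∈ S.Loc v := fun v hv ↦
    (S.Loc v).neg_mem ((S.Loc v).zsmul_mem (hc v hv) _)
  have hrel : S.rK (a₀ • x + a₁ • s) = S.rK (-(a₂ • c)) := by
    rw [map_add, map_zsmul, map_zsmul, map_neg, map_zsmul]
    exact eq_neg_of_add_eq_zero_left h
  obtain ⟨h1, h2⟩ := S.eq_zero_of_rK_eq he hu hue hwe hw hrel
  have ha1 : a₁ • s = 0 := hind a₀ a₁ h1
  rw [ha1, add_zero] at h1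
  exact ⟨h1, ha1, neg_eq_zero.mp h2⟩

/-! ### Claim A: `p^{M₀}` kills `Sel ∩ V^{-ε}` -/

/-- **Claim A (the `-ε`-eigengroup): `p^{M₀} · (Sel ∩ V^{-ε}) = 0`**, ANY prime `p`, visible
Čebotarev. Verbatim `SplitHypothesesM.claimA` (Gross 1991, Claim 10.1 in McCallum's order
language: Cor. 3.2 gives `ℓ` with `ord y_λ = p^{M-M₀}` and `ord s_λ = p^N`; `d_M(ℓ)` is Selmer off
`λ` with `ord d_M(ℓ)_λ = p^{M-M₀}`, so duality forces `N ≤ M₀`), the family `{y, s}` being visible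
by `vis_of_sel_pair`. [cite: GrossLMS1991, §10 Claim 10.1]
[cite: McCallumLMS1991, §5 (proof of Thm. 5.4), Cor. 3.2] [cite: Kolyvagin1989Izv, §3 (l = 2)] -/
theorem claimA {s : V} (hs : s ∈ S.Sel) (hse : s ∈ S.part (-S.ε)) :
    ((S.p : ℤ) ^ S.M₀) • s = 0 := by
  rcases Nat.lt_or_ge S.M₀ S.M with hM₀ | hM₀
  swap
  · exact pow_zsmul_eq_zero_of_le hM₀ (S.torsion s)
  by_cases hN : S.expo s = 0
  · exact pow_zsmul_eq_zero_of_le (Nat.zero_le _) (by simpa [hN] using S.pow_expo_zsmul s)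
  -- Čebotarev: a Kolyvagin prime `ℓ` with `ord y_λ = ord y` and `ord s_λ = ord s`
  obtain ⟨ℓ, -, hℓ, hloc⟩ := S.cebotarev 2 ![S.y, s] ![S.M - S.M₀, S.expo s]
    (fun i ↦ by
      fin_cases i
      · exact S.y_ne hM₀
      · exact S.ne_zero_of_expo_ne_zero hN)
    (fun i ↦ by
      fin_cases i
      · intro _
        exact S.pow_zsmul_y_ne_zero hM₀
      · intro h
        exact S.pow_expo_sub_one_zsmul_ne_zero h)
    (fun i ↦ by
      fin_cases i
      · exact ⟨S.ε, S.hε, S.y_part⟩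
      · exact ⟨-S.ε, S.neg_ε_sign, hse⟩)
    (fun a ha i ↦ by
      rw [Fin.sum_univ_two] at ha
      simp only [Matrix.cons_val_zero, Matrix.cons_val_one] at ha
      have := S.vis_of_sel_pair S.hε S.y_mem S.y_part hs hse ha
      fin_cases i
      · exact this.1
      · exact this.2) 0
  have hy : ((S.p : ℤ) ^ (S.M - S.M₀ - 1)) • S.y ∉ S.A ℓ := by
    have := (hloc 0).2 (by simp only [Matrix.cons_val_zero]; omega)
    simpa using this
  have hsA : ((S.p : ℤ) ^ (S.expo s - 1)) • s ∉ S.A ℓ := by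
    have := (hloc 1).2 (by simpa using hN)
    simpa using this
  -- `d_M(ℓ)` has `ord d_M(ℓ)_λ = ord y_λ = p^{M - M₀}`, Selmer off `λ`, in the `-ε`-eigengroup
  have h1 : ((S.p : ℤ) ^ (S.M - S.M₀ - 1)) • S.c ℓ ∉ S.Loc (S.pl ℓ) := fun h ↦
    hy ((S.c_mem_loc_iff_one hℓ _).mp h)
  have hdual := S.duality ℓ hℓ (-S.ε) S.neg_ε_sign (S.c ℓ) (S.c_part_prime hℓ)
    (fun v hv ↦ S.c_mem_loc_of_ne hℓ hv) s hs hse (S.M - S.M₀ - 1) (by omega) h1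
  rw [show S.M - 1 - (S.M - S.M₀ - 1) = S.M₀ by omega] at hdual
  -- hence `ord s ≤ p^{M₀}`
  have hle : S.expo s ≤ S.M₀ := S.expo_le_of_mem_of_not_mem hdual (fun _ ↦ hsA)
  exact pow_zsmul_eq_zero_of_le hle (S.pow_expo_zsmul s)

/-- **`p^{M₀} c(ℓ) = 0` when `x_λ = 0`** (Gross 1991, Prop. 10.2 (6) ⟹ (1), mod `p^M`): then
`y_λ = 0`, so `d_M(ℓ)_λ = 0` (Prop. 4.4) and `c(ℓ) ∈ Sel ∩ V^{-ε}`, which `p^{M₀}` kills by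
Claim A. [cite: GrossLMS1991, Prop. 10.2] -/
private theorem pow_zsmul_c_eq_zero {ℓ : ℕ} (hℓ : S.Kol ℓ) (hx : S.x ∈ S.A ℓ) :
    ((S.p : ℤ) ^ S.M₀) • S.c ℓ = 0 := by
  refine S.claimA ((S.mem_sel_iff _).mpr fun v ↦ ?_) (S.c_part_prime hℓ)
  by_cases hv : v = S.pl ℓ
  · rw [hv]
    have hy : ((S.p : ℤ) ^ 0) • S.y ∈ S.A ℓ := by
      rw [pow_zero, one_zsmul]
      exact (S.A ℓ).zsmul_mem hx _
    have := (S.c_mem_loc_iff_one hℓ 0).mpr hy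
    rwa [pow_zero, one_zsmul] at this
  · exact S.c_mem_loc_of_ne hℓ hv

/-- The `-ε`-part needs only `p^{M₀}`: restatement of Claim A. [cite: GrossLMS1991, §10 Claim 10.1] -/
theorem pow_zsmul_eq_zero_of_neg_part {s : V} (hs : s ∈ S.Sel) (hse : s ∈ S.part (-S.ε)) :
    ((S.p : ℤ) ^ S.M₀) • s = 0 :=
  S.claimA hs hse

/-- **`M₀ = 0` (the Heegner point is `p`-primitive): `Sel ∩ V^{-ε} = 0`.** At `2` over `ℚ` for the
pair: `Sel_{2^M}(E^{-ε}/ℚ) = 0` for every `M` (given visibility). [cite: GrossLMS1991, §10 Claim 10.1]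
[cite: Kolyvagin1989Izv, Thm. B_l (l = 2)] -/
theorem eq_zero_of_M₀_eq_zero (h0 : S.M₀ = 0) {s : V} (hs : s ∈ S.Sel) (hse : s ∈ S.part (-S.ε)) :
    s = 0 := by
  have := S.claimA hs hse
  rwa [h0, pow_zero, one_zsmul] at this

/-! ### Claim B: `p^{2M₀} · (Sel ∩ V^{ε}) ⊆ ℤ x` -/

/-- **Claim B for classes independent of `x`: `p^{2M₀} s = 0`** for `s ∈ Sel ∩ V^{ε}` with
`ℤ x ∩ ℤ s = 0`, ANY prime `p`, visible Čebotarev. Verbatim `SplitHypothesesM.claimB_indep`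
(Gross 1991, Claim 10.3 in McCallum's order language: `ℓ` with `ord y_λ = p^{M-M₀}`, so
`ord c(ℓ) = p^k ≥ p^{M-M₀}`; then `ℓ' > ℓ` with `x_{λ'} = 0`, `ord s_{λ'} = p^N`,
`ord c(ℓ)_{λ'} = p^k`; `d' = p^{M₀} c(ℓℓ')` is Selmer off `λ'` with `ord d'_{λ'} = p^{k-M₀}`, and
duality gives `N ≤ M - k + M₀ ≤ 2M₀`), the families `{y}` and `{x, s, c(ℓ)}` being visible by
`sel_visible` and `vis_of_sel_sel_kol` (the tie lemma: `c(ℓ)` is supported on `λ`).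
[cite: GrossLMS1991, §10 Claim 10.3] [cite: McCallumLMS1991, §5 (proof of Thm. 5.4), §3 (p. 299)] -/
theorem claimB_indep {s : V} (hs : s ∈ S.Sel) (hse : s ∈ S.part S.ε)
    (hind : ∀ a₀ a₁ : ℤ, a₀ • S.x + a₁ • s = 0 → a₁ • s = 0) :
    ((S.p : ℤ) ^ (2 * S.M₀)) • s = 0 := by
  rcases Nat.lt_or_ge (2 * S.M₀) S.M with hM₀ | hM₀
  swap
  · exact pow_zsmul_eq_zero_of_le hM₀ (S.torsion s)
  have hM₀' : S.M₀ < S.M := by omega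
  by_cases hN : S.expo s = 0
  · exact pow_zsmul_eq_zero_of_le (Nat.zero_le _) (by simpa [hN] using S.pow_expo_zsmul s)
  -- Step A: a Kolyvagin prime `ℓ` with `ord y_λ = ord y = p^{M - M₀}`
  obtain ⟨ℓ, -, hℓ, hloc⟩ := S.cebotarev 1 ![S.y] ![S.M - S.M₀]
    (fun i ↦ by
      fin_cases i
      exact S.y_ne hM₀')
    (fun i ↦ by
      fin_cases i
      intro _
      exact S.pow_zsmul_y_ne_zero hM₀')
    (fun i ↦ by
      fin_cases i
      exact ⟨S.ε, S.hε, S.y_part⟩)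
    (fun a ha i ↦ by
      rw [Fin.sum_univ_one] at ha
      fin_cases i
      simpa using S.zsmul_eq_zero_of_zsmul_rK_eq_zero S.y_mem (by simpa using ha)) 0
  have hy : ((S.p : ℤ) ^ (S.M - S.M₀ - 1)) • S.y ∉ S.A ℓ := by
    have := (hloc 0).2 (by simp only [Matrix.cons_val_zero]; omega)
    simpa using this
  have hcL : ((S.p : ℤ) ^ (S.M - S.M₀ - 1)) • S.c ℓ ∉ S.Loc (S.pl ℓ) := fun h ↦
    hy ((S.c_mem_loc_iff_one hℓ _).mp h)
  -- so `k = expo (c ℓ) ≥ M - M₀`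
  have hk : S.M - S.M₀ ≤ S.expo (S.c ℓ) := by
    by_contra hlt
    have hlt := Nat.lt_of_not_le hlt
    exact hcL (by
      rw [pow_zsmul_eq_zero_of_le (by omega) (S.pow_expo_zsmul (S.c ℓ))]; exact zero_mem _)
  have hk0 : S.expo (S.c ℓ) ≠ 0 := by omega
  -- Step B: `ℓ' > ℓ` with `x_{λ'} = 0`, `ord s_{λ'} = ord s`, `ord c(ℓ)_{λ'} = ord c(ℓ)`
  obtain ⟨ℓ', hlt, hℓ', hloc'⟩ := S.cebotarev 3 ![S.x, s, S.c ℓ] ![0, S.expo s, S.expo (S.c ℓ)]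
    (fun i ↦ by
      fin_cases i
      · exact S.x_ne
      · exact S.ne_zero_of_expo_ne_zero hN
      · exact S.ne_zero_of_expo_ne_zero hk0)
    (fun i ↦ by
      fin_cases i
      · intro h
        exact absurd rfl h
      · intro h
        exact S.pow_expo_sub_one_zsmul_ne_zero h
      · intro h
        exact S.pow_expo_sub_one_zsmul_ne_zero h)
    (fun i ↦ by
      fin_cases i
      · exact ⟨S.ε, S.hε, S.x_part⟩
      · exact ⟨S.ε, S.hε, hse⟩
      · exact ⟨-S.ε, S.neg_ε_sign, S.c_part_prime hℓ⟩)
    (fun a ha i ↦ by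
      rw [Fin.sum_univ_three] at ha
      simp only [Matrix.cons_val_zero, Matrix.cons_val_one, Matrix.cons_val] at ha
      have := S.vis_of_sel_sel_kol S.hε S.x_mem S.x_part hs hse (S.c_part_prime hℓ)
        (fun v hv ↦ S.c_mem_loc_of_forall_ne hℓ hv) hind ha
      fin_cases i
      · exact this.1
      · exact this.2.1
      · exact this.2.2) ℓ
  have hne : ℓ ≠ ℓ' := hlt.ne
  have hxA : S.x ∈ S.A ℓ' := by simpa using (hloc' 0).1
  have hsA : ((S.p : ℤ) ^ (S.expo s - 1)) • s ∉ S.A ℓ' := by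
    have := (hloc' 1).2 (by simpa using hN)
    simpa using this
  have hcA' : ((S.p : ℤ) ^ (S.expo (S.c ℓ) - 1)) • S.c ℓ ∉ S.A ℓ' := by
    have := (hloc' 2).2 (by simpa using hk0)
    simpa using this
  -- Step C: `d' = p^{M₀} c(ℓℓ')` satisfies the Selmer condition exactly off `λ'`
  have hcℓ' : ((S.p : ℤ) ^ S.M₀) • S.c ℓ' = 0 := S.pow_zsmul_c_eq_zero hℓ' hxA
  have hsupp : KolSupp S.Kol (ℓ * ℓ') :=
    kolSupp_mul (S.prime_of_kol ℓ hℓ) (S.prime_of_kol ℓ' hℓ') hne hℓ hℓ'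
  have hsupp' : KolSupp S.Kol (ℓ' * ℓ) := by rwa [mul_comm] at hsupp
  set d' := ((S.p : ℤ) ^ S.M₀) • S.c (ℓ * ℓ') with hd'
  have hd'e : d' ∈ S.part S.ε := (S.part S.ε).zsmul_mem (S.c_part_mul hℓ hℓ' hne) _
  have hatℓ : d' ∈ S.Loc (S.pl ℓ) :=
    (S.c_mem_loc_iff ℓ ℓ' hℓ hsupp S.M₀).mpr (by rw [hcℓ']; exact zero_mem _)
  have hoff : ∀ v, v ≠ S.pl ℓ' → d' ∈ S.Loc v := by
    intro v hv
    by_cases hvℓ : v = S.pl ℓ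
    · rw [hvℓ]
      exact hatℓ
    by_cases hdv : S.Dv v (ℓ * ℓ')
    · rcases S.dv_mul ℓ ℓ' hℓ hℓ' v hdv with h | h
      · exact absurd ((S.dv_iff ℓ hℓ v).mp h) hvℓ
      · exact absurd ((S.dv_iff ℓ' hℓ' v).mp h) hv
    · exact (S.Loc v).zsmul_mem (S.c_mem_loc _ hsupp v hdv) _
  -- at `λ'`: `ord d'_{λ'} = p^{k - M₀}`, i.e. `p^{k - 1 - M₀} d' ∉ Loc λ'`
  have hat : ((S.p : ℤ) ^ (S.expo (S.c ℓ) - 1 - S.M₀)) • d' ∉ S.Loc (S.pl ℓ') := by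
    intro h
    rw [hd', smul_smul, ← pow_add,
      show S.expo (S.c ℓ) - 1 - S.M₀ + S.M₀ = S.expo (S.c ℓ) - 1 by omega, mul_comm ℓ ℓ'] at h
    exact hcA' ((S.c_mem_loc_iff ℓ' ℓ hℓ' hsupp' (S.expo (S.c ℓ) - 1)).mp h)
  have hdual := S.duality ℓ' hℓ' S.ε S.hε d' hd'e hoff s hs hse (S.expo (S.c ℓ) - 1 - S.M₀)
    (by have := S.expo_le (S.c ℓ); omega) hat
  -- hence `expo s ≤ M - 1 - (k - 1 - M₀) ≤ 2 M₀`
  have hle : S.expo s ≤ S.M - 1 - (S.expo (S.c ℓ) - 1 - S.M₀) :=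
    S.expo_le_of_mem_of_not_mem hdual (fun _ ↦ hsA)
  exact pow_zsmul_eq_zero_of_le (by omega) (S.pow_expo_zsmul s)

/-- **Splitting off `x`**: there are `k : ℤ` and `s'` with `s = k • x + s'` and `ℤ x ∩ ℤ s' = 0`
(`x` has the maximal order `p^M`). [folklore] -/
private theorem exists_split (s : V) :
    ∃ (k : ℤ) (s' : V), s = k • S.x + s' ∧ ∀ a₀ a₁ : ℤ, a₀ • S.x + a₁ • s' = 0 → a₁ • s' = 0 := by
  -- `b` = least exponent with `p^b s ∈ ℤ x`
  have hex : ∃ b : ℕ, ∃ k : ℤ, ((S.p : ℤ) ^ b) • s = k • S.x :=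
    ⟨S.M, 0, by rw [S.torsion, zero_zsmul]⟩
  set b := Nat.find hex with hb
  obtain ⟨k, hk⟩ : ∃ k : ℤ, ((S.p : ℤ) ^ b) • s = k • S.x := Nat.find_spec hex
  have hmin : ∀ j < b, ∀ k' : ℤ, ((S.p : ℤ) ^ j) • s ≠ k' • S.x := fun j hj k' h ↦
    Nat.find_min hex hj ⟨k', h⟩
  -- `p^b ∣ k`: `p^{M-b} k x = p^M s = 0`
  have hbM : b ≤ S.M := Nat.find_min' hex ⟨0, by rw [S.torsion, zero_zsmul]⟩
  have hdvd : ((S.p : ℤ) ^ b) ∣ k := by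
    have h0 : (((S.p : ℤ) ^ (S.M - b)) * k) • S.x = 0 := by
      rw [mul_zsmul, ← hk, smul_smul, ← pow_add, Nat.sub_add_cancel hbM, S.torsion]
    have h1 : (S.p : ℤ) ^ (S.M - b) * (S.p : ℤ) ^ b ∣ (S.p : ℤ) ^ (S.M - b) * k := by
      rw [← pow_add, Nat.sub_add_cancel hbM]
      exact (S.zsmul_x_eq_zero_iff _).mp h0
    have hpne : ((S.p : ℤ) ^ (S.M - b)) ≠ 0 := pow_ne_zero _ (by exact_mod_cast S.hp.ne_zero)
    exact (mul_dvd_mul_iff_left hpne).mp h1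
  obtain ⟨k', rfl⟩ := hdvd
  refine ⟨k', s - k' • S.x, by abel, fun a₀ a₁ h ↦ ?_⟩
  -- independence: if `a₁ (s - k' x) ∈ ℤ x` with `p^j ∥ a₁`, `j < b`, minimality is violated
  have hs' : ((S.p : ℤ) ^ b) • (s - k' • S.x) = 0 := by
    rw [zsmul_sub, hk, smul_smul]
    exact sub_self _
  by_cases ha₁ : a₁ = 0
  · rw [ha₁, zero_zsmul]
  obtain ⟨j, β, hβ, rfl⟩ : ∃ j : ℕ, ∃ β : ℤ, ¬ (S.p : ℤ) ∣ β ∧ a₁ = (S.p : ℤ) ^ j * β := by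
    have hfin : FiniteMultiplicity (S.p : ℤ) a₁ :=
      Int.finiteMultiplicity_iff.mpr ⟨by rw [Int.natAbs_natCast]; exact S.hp.one_lt.ne', ha₁⟩
    obtain ⟨β, hβ, hnd⟩ := hfin.exists_eq_pow_mul_and_not_dvd
    exact ⟨multiplicity (S.p : ℤ) a₁, β, hnd, hβ⟩
  rcases Nat.lt_or_ge j b with hjb | hjb
  · exfalso
    obtain ⟨u, hu⟩ := exists_mul_zsmul_eq_of_not_dvd S.hp S.torsion hβ
    have h1 : ((S.p : ℤ) ^ j * β) • (s - k' • S.x) = (-a₀) • S.x := by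
      rw [neg_smul]
      exact eq_neg_of_add_eq_zero_right h
    have h2 : ((S.p : ℤ) ^ j) • (s - k' • S.x) = (u * -a₀) • S.x :=
      calc ((S.p : ℤ) ^ j) • (s - k' • S.x)
          = (u * β) • (((S.p : ℤ) ^ j) • (s - k' • S.x)) := (hu _).symm
        _ = u • (((S.p : ℤ) ^ j * β) • (s - k' • S.x)) := by
          rw [smul_smul, smul_smul]
          congr 1
          ring
        _ = u • ((-a₀) • S.x) := by rw [h1]
        _ = (u * -a₀) • S.x := smul_smul _ _ _
    have h3 : ((S.p : ℤ) ^ j) • s =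
        ((S.p : ℤ) ^ j) • (s - k' • S.x) + (((S.p : ℤ) ^ j) * k') • S.x := by
      rw [smul_sub, mul_smul]
      abel
    exact hmin j hjb _ (by rw [h3, h2, ← add_smul])
  · rw [mul_comm, mul_smul, pow_zsmul_eq_zero_of_le hjb hs', smul_zero]

/-- **Claim B (the `ε`-eigengroup): `p^{2M₀} s ∈ ℤ x` for every `s ∈ Sel ∩ V^{ε}`**, any prime
`p`, visible Čebotarev (split `s = k x + s'`, `s'` independent of `x`, and apply `claimB_indep`).
[cite: GrossLMS1991, §10 Claim 10.3] -/
theorem claimB {s : V} (hs : s ∈ S.Sel) (hse : s ∈ S.part S.ε) :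
    ∃ a : ℤ, ((S.p : ℤ) ^ (2 * S.M₀)) • s = a • S.x := by
  obtain ⟨k, s', hsplit, hind⟩ := S.exists_split s
  have hs'eq : s' = s - k • S.x := by rw [hsplit]; abel
  have hs' : s' ∈ S.Sel := by
    rw [hs'eq]
    exact S.Sel.sub_mem hs (S.Sel.zsmul_mem S.x_mem _)
  have hs'e : s' ∈ S.part S.ε := by
    rw [hs'eq]
    exact (S.part S.ε).sub_mem hse ((S.part S.ε).zsmul_mem S.x_part _)
  have h0 := S.claimB_indep hs' hs'e hind
  refine ⟨(S.p : ℤ) ^ (2 * S.M₀) * k, ?_⟩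
  rw [hsplit, zsmul_add, h0, add_zero, smul_smul]

/-! ### The annihilation theorem and the exact case `M₀ = 0`, any prime `p` -/

/-- **Kolyvagin's annihilation modulo `p^M`, visible split form, ANY prime `p`:
`p^{2M₀} · Sel ⊆ ℤ x`.** `s = s⁺ + s⁻` (`sel_split`); `p^{M₀} s⁻ = 0` by Claim A and
`p^{2M₀} s⁺ ∈ ℤ x` by Claim B. At `p = 2` for the pair `(E, E^D)` over `ℚ` (Kolyvagin 1989, §3)
this is the exponent form of the `2`-part of Kolyvagin's Theorems B and C for VISIBLE pairs.
[cite: GrossLMS1991, Thm. 1.3 and §10] [cite: McCallumLMS1991, §1 Theorem (Kolyvagin), §5]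
[cite: Kolyvagin1989Izv, Thm. B_l (l = 2), §3] -/
private theorem exists_pow_zsmul_eq_zsmul {s : V} (hs : s ∈ S.Sel) :
    ∃ a : ℤ, ((S.p : ℤ) ^ (2 * S.M₀)) • s = a • S.x := by
  obtain ⟨sp, sm, ⟨hsp, hspe⟩, ⟨hsm, hsme⟩, hsum⟩ := S.sel_split_ε hs
  have hsm0 : ((S.p : ℤ) ^ (2 * S.M₀)) • sm = 0 :=
    pow_zsmul_eq_zero_of_le (by omega) (S.claimA hsm hsme)
  obtain ⟨a, ha⟩ := S.claimB hsp hspe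
  exact ⟨a, by rw [hsum, zsmul_add, hsm0, add_zero, ha]⟩

/-- **`M₀ = 0`: `Sel = ℤ x` and `Sel ∩ V^{-ε} = 0`** (Gross's Prop. 2.3 shape; at `2` over `ℚ` for
a visible pair: `Sel_{2^M}(E^{ε}/ℚ) = ℤ/2^M · x`, `Sel_{2^M}(E^{-ε}/ℚ) = 0` for every `M`).
[cite: GrossLMS1991, Prop. 2.3 (§10)] [cite: Kolyvagin1989Izv, Thm. B_l (l = 2)] -/
theorem sel_eq_zmultiples_of_M₀_eq_zero (h0 : S.M₀ = 0) :
    S.Sel = AddSubgroup.zmultiples S.x ∧ S.Sel ⊓ S.part (-S.ε) = ⊥ := by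
  refine ⟨le_antisymm (fun s hs ↦ ?_) (AddSubgroup.zmultiples_le_of_mem S.x_mem), ?_⟩
  · obtain ⟨a, ha⟩ := S.exists_pow_zsmul_eq_zsmul (s := s) hs
    rw [h0, mul_zero, pow_zero, one_zsmul] at ha
    exact ⟨a, ha.symm⟩
  · rw [eq_bot_iff]
    intro s hs
    rw [AddSubgroup.mem_inf] at hs
    rw [AddSubgroup.mem_bot]
    exact S.eq_zero_of_M₀_eq_zero h0 hs.1 hs.2

/-! ### The lower-bound element `c_{M₀}(ℓ) ∈ Sel ∩ V^{-ε}` (`M₀ − M₁ ≤ N₁`) -/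

/-- Every multiple of `c_M(ℓ)` lies in `V^{-ε}`. [cite: GrossLMS1991, Prop. 5.4 (2)] -/
theorem pow_zsmul_c_mem_part_neg {ℓ : ℕ} (hℓ : S.Kol ℓ) (a : ℕ) :
    ((S.p : ℤ) ^ a) • S.c ℓ ∈ S.part (-S.ε) :=
  (S.part (-S.ε)).zsmul_mem (S.c_part_prime hℓ) _

/-- **`c_{M₀}(ℓ) = p^{M−M₀} c_M(ℓ)` is a Selmer class for EVERY Kolyvagin prime `ℓ`** (`M₀ ≤ M`;
Lemma 4.3 off `λ`, Prop. 4.4 at `λ`; McCallum 1991, §5: *"`d_{M_{r-1}}(n) ∈ Ш(E/K)`"*, read at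
level `M` by Lemma 4.6). [cite: McCallumLMS1991, §5 (d_{M_{r-1}}(n) ∈ Ш) and Lemma 4.6] -/
theorem pow_zsmul_c_mem_sel_inf_part (hM₀ : S.M₀ ≤ S.M) {ℓ : ℕ} (hℓ : S.Kol ℓ) :
    ((S.p : ℤ) ^ (S.M - S.M₀)) • S.c ℓ ∈ S.Sel ⊓ S.part (-S.ε) := by
  refine AddSubgroup.mem_inf.mpr ⟨(S.mem_sel_iff _).mpr fun v ↦ ?_, S.pow_zsmul_c_mem_part_neg hℓ _⟩
  by_cases hv : v = S.pl ℓ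
  · rw [hv]
    refine (S.c_mem_loc_iff_one hℓ _).mpr ?_
    rw [show S.y = ((S.p : ℤ) ^ S.M₀) • S.x from rfl, smul_smul, ← pow_add,
      Nat.sub_add_cancel hM₀, S.torsion]
    exact zero_mem _
  · exact (S.Loc v).zsmul_mem (S.c_mem_loc_of_ne hℓ hv) _

/-- **The lower-bound element of exact order** (McCallum 1991, proof of Thm. 5.4, case `i = 1`:
`M₀ − M₁ ≤ N₁`): if `p^{M−m−1} c_M(ℓ) ≠ 0` and `p^{M−m} c_M(ℓ) = 0` (`p^m ∥ P_ℓ`) with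
`m < M₀ ≤ M`, then `t = c_{M₀}(ℓ) ∈ Sel ∩ V^{-ε}` has order EXACTLY `p^{M₀−m}`.
[cite: McCallumLMS1991, §5 Thm. 5.4 (proof, case i = 1)] -/
theorem exists_mem_sel_part_neg_of_order (hM₀ : S.M₀ ≤ S.M) {m : ℕ} (hm : m < S.M₀)
    {ℓ : ℕ} (hℓ : S.Kol ℓ) (hc : ((S.p : ℤ) ^ (S.M - m - 1)) • S.c ℓ ≠ 0)
    (hc' : ((S.p : ℤ) ^ (S.M - m)) • S.c ℓ = 0) :
    ∃ t ∈ S.Sel, t ∈ S.part (-S.ε) ∧ ((S.p : ℤ) ^ (S.M₀ - m - 1)) • t ≠ 0 ∧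
      ((S.p : ℤ) ^ (S.M₀ - m)) • t = 0 := by
  have hmem := AddSubgroup.mem_inf.mp (S.pow_zsmul_c_mem_sel_inf_part hM₀ hℓ)
  refine ⟨((S.p : ℤ) ^ (S.M - S.M₀)) • S.c ℓ, hmem.1, hmem.2, ?_, ?_⟩
  · rw [smul_smul, ← pow_add, show S.M₀ - m - 1 + (S.M - S.M₀) = S.M - m - 1 by omega]
    exact hc
  · rw [smul_smul, ← pow_add, show S.M₀ - m + (S.M - S.M₀) = S.M - m by omega]
    exact hc'

end VisibleSplitHypothesesM

/-! ## The split data (product-form Čebotarev) are visible data: the visible form GENERALISES -/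

namespace SplitHypothesesM

variable {V : Type*} [AddCommGroup V] {Pl : Type*} (S : SplitHypothesesM V Pl)

/-- **Split data are visible data** with `H = V`, `rK = id`, `LocK ℓ = Loc λ`: visibility of
`Sel` and the factorisation are tautological and independence after `rK` is independence in `V`,
so the product-form axiom `SplitHypothesesM.cebotarev` implies the visible one. Hence every
theorem of `VisibleSplitHypothesesM` applies to `SplitHypothesesM` (and, through
`HypothesesM.toSplit`, to the tree's `τ`-form data at `p` odd). [cite: McCallumLMS1991, §3, §5]
[cite: GrossLMS1991, Prop. 9.1 and §10] -/
def toVisible : VisibleSplitHypothesesM V Pl V where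
  p := S.p
  hp := S.hp
  M := S.M
  torsion := S.torsion
  part := S.eig
  part_disjoint := S.eig_disjoint
  Sel := S.Sel
  sel_split := S.sel_split
  Loc := S.Loc
  mem_sel_iff := S.mem_sel_iff
  Kol := S.Kol
  prime_of_kol := S.prime_of_kol
  pl := S.pl
  Dv := S.Dv
  dv_iff := S.dv_iff
  dv_mul := S.dv_mul
  A := S.A
  x := S.x
  x_mem := S.x_mem
  x_ord := S.x_ord
  M₀ := S.M₀
  ε := S.ε
  hε := S.hε
  x_part := S.x_eig
  c := S.c
  c_one := S.c_one
  c_part := S.c_eig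
  c_mem_loc := S.c_mem_loc
  c_mem_loc_iff := S.c_mem_loc_iff
  duality := S.duality
  rK := AddMonoidHom.id V
  LocK ℓ := S.Loc (S.pl ℓ)
  mem_loc_pl_iff _ _ _ _ := Iff.rfl
  sel_visible _ _ h := h
  cebotarev r cs Nv hne hN heig hind b := S.cebotarev r cs Nv hne hN heig hind b

-- Cross-check (`example`s, not declarations): the split form's Claims A and B
-- (`SplitHypothesesM.claimA` / `claimB`) re-derived through the visible form.
example {s : V} (hs : s ∈ S.Sel) (hse : s ∈ S.eig (-S.ε)) : ((S.p : ℤ) ^ S.M₀) • s = 0 :=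
  S.toVisible.claimA (s := s) hs hse

example {s : V} (hs : s ∈ S.Sel) (hse : s ∈ S.eig S.ε) :
    ∃ a : ℤ, ((S.p : ℤ) ^ (2 * S.M₀)) • s = a • S.x :=
  S.toVisible.claimB (s := s) hs hse

end SplitHypothesesM

end KolyvaginDescent

end Literature.NumberTheory.EllipticCurves

end
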